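import Summits.AtomisticToContinuum.Crystallization.Theorems.FrustratedLawDichotomyTwoShellRigidityCapBraceAlg

/-!
# FrustratedLawDichotomy · two-shell rigidity — the CAP BRACE, part B/3: the octahedral brace lemma `octaBrace`
# (decomp-a2c, lens 3, gen 35; beneath slot 3 of `OverbindingBudgetTwoShellShape`)

Part B of three (A = `…TwoShellRigidityCapBraceAlg`, C = `…TwoShellRigidityCapBrace`).

`octaBrace` — six points `O` (centre, the origin), `b, b'` (the `√2`-pair of the link of `O`), `c, c'` (its two common contacts), `q`
(the cap); with `t` the bond tolerance, `d = nn_O` and `nb, nb', nc, nc'` the nearest-neighbour distances at `b, b', c, c'`, the twelve cell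
edges `O–x`, `x–y` (`x ∈ {b,b'}`, `y ∈ {c,c'}`), `q–x` lie in the PER-SITE windows `[nn, (1+t)·nn]` of both endpoints among `O, b, b', c, c'`
(the cap's own scale is not needed), and the diagonals satisfy `‖b − b'‖ ≥ nb`, `‖c − c'‖ ≥ nc`, `‖q‖ ≥ d`.  Then
`|⟪b, b'⟫| ≤ (7/2)·t·‖b‖‖b'‖` for `0 < t ≤ 1/100` (first-order truth `3t`).

Proof («exact first order + Binet–Cauchy second order», no a-priori fit, no trigonometry): with `m = b − b'`, `n = c − c'`, `p = b + b'`,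
`ρ = c + c'`, `w = p − ρ`, `ν = m × n`, `D = ‖ν‖²`, polarization makes `⟪q,m⟫, ⟪q,n⟫, ⟪p,m⟫, ⟪m,n⟫, ⟪w,m⟫, ⟪w,n⟫` (`≤ K`) and `⟪p,n⟫`
(`≤ 2K`) signed sums of window widths, `K = (103/50)·t·d²`, EXACTLY; part A's `inplane_le` then gives `D‖v‖² − ⟪v,ν⟫² ≤ A_v t²d²·D` for
`v = q, p, w` (`A = 9, 23, 9`), `proj_cs` bounds the three mixed pairings, `delta_bound` pins `Δ = ‖p‖² − ⟪p,ρ⟫ − ⟪q,p⟫ + ⟪q,ρ⟫` to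
`|Δ| ≤ (2/5)·t·d²`, and `2⟪b,b'⟫ − Δ` is a signed sum of twelve window widths paired by common site (`≤ 3K`).

`[folklore]` elementary; no definitions, no `sorry`, no `instance`/`notation`.
-/

noncomputable section

namespace Summit.AtomisticToContinuum.Crystallization.Theorems.FrustratedLawDichotomyTwoShellRigidityCapBrace

open Literature.Geometry.DiscreteGeometry
open Summit.AtomisticToContinuum.Crystallization.Theorems.FrustratedLawDichotomyTwoShellRigidityCut
open Summit.AtomisticToContinuum.Crystallization.Theorems.FrustratedLawDichotomyTwoShellRigidityLsLedger
  (cross cross_apply_zero cross_apply_one cross_apply_two norm_cross_sq)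
open scoped RealInnerProductSpace

/-! ## §4 The octahedral brace lemma -/

/-- **Octahedral brace lemma (per-site windows).**  Six points `O = 0`, `b, b'` (a `√2`-pair of the link of `O`), `c, c'` (its two common
contacts) and `q` (the cap).  Hypotheses: with `t` the bond tolerance, `d = nn_O` and `nb, nb', nc, nc'` the nearest-neighbour distances at
`b, b', c, c'`, every one of the twelve cell edges `O–x` (`x = b,b',c,c'`), `x–y` (`x ∈ {b,b'}`, `y ∈ {c,c'}`), `q–x` lies in the window
`[nn, (1+t)·nn]` of each of its endpoints among `O, b, b', c, c'` (this is `bondGraph_adj` + `nearestDist_le_dist`), and the diagonals satisfy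
`‖b − b'‖ ≥ nb`, `‖c − c'‖ ≥ nc`, `‖q‖ ≥ d` (`nearestDist_le_dist` again).  Conclusion: `|⟪b, b'⟫| ≤ (7/2)·t·‖b‖·‖b'‖` whenever
`0 < t ≤ 1/100`.  (The windows at the cap's own site are not needed.) [folklore] -/
theorem octaBrace {t d nb nb' nc nc' : ℝ} {b b' c c' q : E3} (ht0 : 0 < t) (ht : t ≤ 1 / 100) (hd : 0 < d)
    (hOb : d ≤ ‖b‖ ∧ ‖b‖ ≤ (1 + t) * d) (hOb' : d ≤ ‖b'‖ ∧ ‖b'‖ ≤ (1 + t) * d)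
    (hOc : d ≤ ‖c‖ ∧ ‖c‖ ≤ (1 + t) * d) (hOc' : d ≤ ‖c'‖ ∧ ‖c'‖ ≤ (1 + t) * d)
    (hBb : nb ≤ ‖b‖ ∧ ‖b‖ ≤ (1 + t) * nb) (hBb' : nb' ≤ ‖b'‖ ∧ ‖b'‖ ≤ (1 + t) * nb')
    (hCc : nc ≤ ‖c‖ ∧ ‖c‖ ≤ (1 + t) * nc) (hCc' : nc' ≤ ‖c'‖ ∧ ‖c'‖ ≤ (1 + t) * nc')
    (hBbc : nb ≤ ‖b - c‖ ∧ ‖b - c‖ ≤ (1 + t) * nb) (hCbc : nc ≤ ‖b - c‖ ∧ ‖b - c‖ ≤ (1 + t) * nc)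
    (hBbc' : nb ≤ ‖b - c'‖ ∧ ‖b - c'‖ ≤ (1 + t) * nb) (hCbc' : nc' ≤ ‖b - c'‖ ∧ ‖b - c'‖ ≤ (1 + t) * nc')
    (hBb'c : nb' ≤ ‖b' - c‖ ∧ ‖b' - c‖ ≤ (1 + t) * nb') (hCb'c : nc ≤ ‖b' - c‖ ∧ ‖b' - c‖ ≤ (1 + t) * nc)
    (hBb'c' : nb' ≤ ‖b' - c'‖ ∧ ‖b' - c'‖ ≤ (1 + t) * nb') (hCb'c' : nc' ≤ ‖b' - c'‖ ∧ ‖b' - c'‖ ≤ (1 + t) * nc')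
    (hBq : nb ≤ ‖q - b‖ ∧ ‖q - b‖ ≤ (1 + t) * nb) (hBq' : nb' ≤ ‖q - b'‖ ∧ ‖q - b'‖ ≤ (1 + t) * nb')
    (hCq : nc ≤ ‖q - c‖ ∧ ‖q - c‖ ≤ (1 + t) * nc) (hCq' : nc' ≤ ‖q - c'‖ ∧ ‖q - c'‖ ≤ (1 + t) * nc')
    (hDb : nb ≤ ‖b - b'‖) (hDc : nc ≤ ‖c - c'‖) (hDq : d ≤ ‖q‖) :
    |⟪b, b'⟫| ≤ 7 / 2 * t * (‖b‖ * ‖b'‖) := by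
  -- scales are positive
  have h1t : 0 < 1 + t := by linarith
  have hnb : 0 < nb := pos_of_mul_pos_right (hd.trans_le (hOb.1.trans hBb.2)) h1t.le
  have hnb' : 0 < nb' := pos_of_mul_pos_right (hd.trans_le (hOb'.1.trans hBb'.2)) h1t.le
  have hnc : 0 < nc := pos_of_mul_pos_right (hd.trans_le (hOc.1.trans hCc.2)) h1t.le
  have hnc' : 0 < nc' := pos_of_mul_pos_right (hd.trans_le (hOc'.1.trans hCc'.2)) h1t.le
  have hd2 : 0 < d ^ 2 := by positivity
  have htd : t * d ^ 2 ≤ 1 / 100 * d ^ 2 := mul_le_mul_of_nonneg_right ht hd2.le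
  have htd0 : 0 ≤ t * d ^ 2 := mul_nonneg ht0.le hd2.le
  -- window widths `((1+t)² − 1)·nn² ≤ K`
  have eO : ((1 + t) ^ 2 - 1) * d ^ 2 ≤ 103 / 50 * t * d ^ 2 :=
    excess_le ht0 ht hd.le (by linarith only [mul_nonneg ht0.le hd.le])
  have eB : ((1 + t) ^ 2 - 1) * nb ^ 2 ≤ 103 / 50 * t * d ^ 2 := excess_le ht0 ht hnb.le (hBb.1.trans hOb.2)
  have eB' : ((1 + t) ^ 2 - 1) * nb' ^ 2 ≤ 103 / 50 * t * d ^ 2 := excess_le ht0 ht hnb'.le (hBb'.1.trans hOb'.2)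
  have eC : ((1 + t) ^ 2 - 1) * nc ^ 2 ≤ 103 / 50 * t * d ^ 2 := excess_le ht0 ht hnc.le (hCc.1.trans hOc.2)
  have eC' : ((1 + t) ^ 2 - 1) * nc' ^ 2 ≤ 103 / 50 * t * d ^ 2 := excess_le ht0 ht hnc'.le (hCc'.1.trans hOc'.2)
  -- squared windows
  obtain ⟨wOb1, wOb2⟩ := sq_win hd.le hOb.1 hOb.2
  obtain ⟨wOb'1, wOb'2⟩ := sq_win hd.le hOb'.1 hOb'.2
  obtain ⟨wOc1, wOc2⟩ := sq_win hd.le hOc.1 hOc.2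
  obtain ⟨wOc'1, wOc'2⟩ := sq_win hd.le hOc'.1 hOc'.2
  obtain ⟨wBb1, wBb2⟩ := sq_win hnb.le hBb.1 hBb.2
  obtain ⟨wBb'1, wBb'2⟩ := sq_win hnb'.le hBb'.1 hBb'.2
  obtain ⟨wCc1, wCc2⟩ := sq_win hnc.le hCc.1 hCc.2
  obtain ⟨wCc'1, wCc'2⟩ := sq_win hnc'.le hCc'.1 hCc'.2
  obtain ⟨wBbc1, wBbc2⟩ := sq_win hnb.le hBbc.1 hBbc.2
  obtain ⟨wCbc1, wCbc2⟩ := sq_win hnc.le hCbc.1 hCbc.2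
  obtain ⟨wBbc'1, wBbc'2⟩ := sq_win hnb.le hBbc'.1 hBbc'.2
  obtain ⟨wCbc'1, wCbc'2⟩ := sq_win hnc'.le hCbc'.1 hCbc'.2
  obtain ⟨wBb'c1, wBb'c2⟩ := sq_win hnb'.le hBb'c.1 hBb'c.2
  obtain ⟨wCb'c1, wCb'c2⟩ := sq_win hnc.le hCb'c.1 hCb'c.2
  obtain ⟨wBb'c'1, wBb'c'2⟩ := sq_win hnb'.le hBb'c'.1 hBb'c'.2
  obtain ⟨wCb'c'1, wCb'c'2⟩ := sq_win hnc'.le hCb'c'.1 hCb'c'.2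
  obtain ⟨wBq1, wBq2⟩ := sq_win hnb.le hBq.1 hBq.2
  obtain ⟨wBq'1, wBq'2⟩ := sq_win hnb'.le hBq'.1 hBq'.2
  obtain ⟨wCq1, wCq2⟩ := sq_win hnc.le hCq.1 hCq.2
  obtain ⟨wCq'1, wCq'2⟩ := sq_win hnc'.le hCq'.1 hCq'.2
  have wDb : nb ^ 2 ≤ ‖b - b'‖ ^ 2 := pow_le_pow_left₀ hnb.le hDb 2
  have wDc : nc ^ 2 ≤ ‖c - c'‖ ^ 2 := pow_le_pow_left₀ hnc.le hDc 2
  have wDq : d ^ 2 ≤ ‖q‖ ^ 2 := pow_le_pow_left₀ hd.le hDq 2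
  -- polarization
  have pbc := norm_sub_sq_real b c
  have pbc' := norm_sub_sq_real b c'
  have pb'c := norm_sub_sq_real b' c
  have pb'c' := norm_sub_sq_real b' c'
  have pqb := norm_sub_sq_real q b
  have pqb' := norm_sub_sq_real q b'
  have pqc := norm_sub_sq_real q c
  have pqc' := norm_sub_sq_real q c'
  -- the composite vectors `m, n, p, ρ, w = p − ρ, ν = m × n`
  obtain ⟨m, hm⟩ : ∃ m : E3, m = b - b' := ⟨_, rfl⟩
  obtain ⟨n, hn⟩ : ∃ n : E3, n = c - c' := ⟨_, rfl⟩
  obtain ⟨p, hp⟩ : ∃ p : E3, p = b + b' := ⟨_, rfl⟩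
  obtain ⟨ρ, hρ⟩ : ∃ ρ : E3, ρ = c + c' := ⟨_, rfl⟩
  obtain ⟨w, hw⟩ : ∃ w : E3, w = p - ρ := ⟨_, rfl⟩
  obtain ⟨ν, hν⟩ : ∃ ν : E3, ν = cross m n := ⟨_, rfl⟩
  have cbb : ⟪b', b⟫ = ⟪b, b'⟫ := real_inner_comm _ _
  have ccc : ⟪c', c⟫ = ⟪c, c'⟫ := real_inner_comm _ _
  have ccb : ⟪c, b⟫ = ⟪b, c⟫ := real_inner_comm _ _
  have cc'b : ⟪c', b⟫ = ⟪b, c'⟫ := real_inner_comm _ _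
  have ccb' : ⟪c, b'⟫ = ⟪b', c⟫ := real_inner_comm _ _
  have cc'b' : ⟪c', b'⟫ = ⟪b', c'⟫ := real_inner_comm _ _
  have hM : ‖m‖ ^ 2 = ‖b - b'‖ ^ 2 := by rw [hm]
  have hN : ‖n‖ ^ 2 = ‖c - c'‖ ^ 2 := by rw [hn]
  have hqm : ⟪q, m⟫ = ⟪q, b⟫ - ⟪q, b'⟫ := by rw [hm, inner_sub_right]
  have hqn : ⟪q, n⟫ = ⟪q, c⟫ - ⟪q, c'⟫ := by rw [hn, inner_sub_right]
  have hpm : ⟪p, m⟫ = ‖b‖ ^ 2 - ‖b'‖ ^ 2 := by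
    rw [hp, hm]; simp only [inner_add_left, inner_sub_right, real_inner_self_eq_norm_sq, cbb]; ring
  have hpn : ⟪p, n⟫ = ⟪b, c⟫ - ⟪b, c'⟫ + ⟪b', c⟫ - ⟪b', c'⟫ := by
    rw [hp, hn]; simp only [inner_add_left, inner_sub_right]; ring
  have hmn : ⟪m, n⟫ = ⟪b, c⟫ - ⟪b, c'⟫ - ⟪b', c⟫ + ⟪b', c'⟫ := by
    rw [hm, hn]; simp only [inner_sub_left, inner_sub_right]; ring
  have hρm : ⟪ρ, m⟫ = ⟪b, c⟫ - ⟪b', c⟫ + ⟪b, c'⟫ - ⟪b', c'⟫ := by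
    rw [hρ, hm]; simp only [inner_add_left, inner_sub_right, ccb, cc'b, ccb', cc'b']; ring
  have hρn : ⟪ρ, n⟫ = ‖c‖ ^ 2 - ‖c'‖ ^ 2 := by
    rw [hρ, hn]; simp only [inner_add_left, inner_sub_right, real_inner_self_eq_norm_sq, ccc]; ring
  have hwm : ⟪w, m⟫ = ⟪p, m⟫ - ⟪ρ, m⟫ := by rw [hw, inner_sub_left]
  have hwn : ⟪w, n⟫ = ⟪p, n⟫ - ⟪ρ, n⟫ := by rw [hw, inner_sub_left]
  have hqp : ⟪q, p⟫ = ⟪q, b⟫ + ⟪q, b'⟫ := by rw [hp, inner_add_right]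
  have hqρ : ⟪q, ρ⟫ = ⟪q, c⟫ + ⟪q, c'⟫ := by rw [hρ, inner_add_right]
  have hg : ⟪p, ρ⟫ = ⟪b, c⟫ + ⟪b, c'⟫ + ⟪b', c⟫ + ⟪b', c'⟫ := by
    rw [hp, hρ]; simp only [inner_add_left, inner_add_right]; ring
  have hpp : ‖p‖ ^ 2 = ‖b‖ ^ 2 + 2 * ⟪b, b'⟫ + ‖b'‖ ^ 2 := by rw [hp]; exact norm_add_sq_real b b'
  have hqw : ⟪q, w⟫ = ⟪q, p⟫ - ⟪q, ρ⟫ := by rw [hw, inner_sub_right]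
  have hpw : ⟪p, w⟫ = ‖p‖ ^ 2 - ⟪p, ρ⟫ := by rw [hw, inner_sub_right, real_inner_self_eq_norm_sq]
  have hwν : ⟪w, ν⟫ = ⟪p, ν⟫ - ⟪ρ, ν⟫ := by rw [hw, inner_sub_left]
  have hD : ‖ν‖ ^ 2 = ‖m‖ ^ 2 * ‖n‖ ^ 2 - ⟪m, n⟫ ^ 2 := by rw [hν]; exact norm_cross_sq m n
  -- first order: every pairing with `m` or `n` is a signed sum of window widths
  have bqm : |⟪q, m⟫| ≤ 103 / 50 * t * d ^ 2 := by
    rw [hqm, abs_le]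
    constructor <;> linarith only [pqb, pqb', wBb1, wBb2, wBq1, wBq2, wBb'1, wBb'2, wBq'1, wBq'2, eB, eB']
  have bqn : |⟪q, n⟫| ≤ 103 / 50 * t * d ^ 2 := by
    rw [hqn, abs_le]
    constructor <;> linarith only [pqc, pqc', wCc1, wCc2, wCq1, wCq2, wCc'1, wCc'2, wCq'1, wCq'2, eC, eC']
  have bpm : |⟪p, m⟫| ≤ 103 / 50 * t * d ^ 2 := by
    rw [hpm, abs_le]
    constructor <;> linarith only [wOb1, wOb2, wOb'1, wOb'2, eO]
  have bpn : |⟪p, n⟫| ≤ 2 * (103 / 50 * t * d ^ 2) := by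
    rw [hpn, abs_le]
    constructor <;> linarith only [pbc, pbc', pb'c, pb'c', wOc1, wOc2, wOc'1, wOc'2, eO, wBbc1, wBbc2, wBbc'1, wBbc'2, eB,
      wBb'c1, wBb'c2, wBb'c'1, wBb'c'2, eB']
  have bmn : |⟪m, n⟫| ≤ 103 / 50 * t * d ^ 2 := by
    rw [hmn, abs_le]
    constructor <;> linarith only [pbc, pbc', pb'c, pb'c', wBbc1, wBbc2, wBbc'1, wBbc'2, eB, wBb'c1, wBb'c2, wBb'c'1,
      wBb'c'2, eB']
  have bwm : |⟪w, m⟫| ≤ 103 / 50 * t * d ^ 2 := by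
    rw [hwm, hpm, hρm, abs_le]
    constructor <;> linarith only [pbc, pb'c, pbc', pb'c', wCbc1, wCbc2, wCb'c1, wCb'c2, eC, wCbc'1, wCbc'2, wCb'c'1,
      wCb'c'2, eC']
  have bwn : |⟪w, n⟫| ≤ 103 / 50 * t * d ^ 2 := by
    rw [hwn, hpn, hρn, abs_le]
    constructor <;> linarith only [pbc, pbc', pb'c, pb'c', wBbc1, wBbc2, wBbc'1, wBbc'2, eB, wBb'c1, wBb'c2, wBb'c'1,
      wBb'c'2, eB']
  have bκb : |⟪q, p⟫ - ‖q‖ ^ 2| ≤ 103 / 50 * t * d ^ 2 := by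
    rw [hqp, abs_le]
    constructor <;> linarith only [pqb, pqb', wBb1, wBb2, wBq1, wBq2, wBb'1, wBb'2, wBq'1, wBq'2, eB, eB']
  have bκc : |⟪q, ρ⟫ - ‖q‖ ^ 2| ≤ 103 / 50 * t * d ^ 2 := by
    rw [hqρ, abs_le]
    constructor <;> linarith only [pqc, pqc', wCc1, wCc2, wCq1, wCq2, wCc'1, wCc'2, wCq'1, wCq'2, eC, eC']
  have bW : |⟪p, ρ⟫ + ⟪q, p⟫ - ⟪q, ρ⟫ - ‖b‖ ^ 2 - ‖b'‖ ^ 2| ≤ 3 * (103 / 50 * t * d ^ 2) := by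
    rw [hg, hqp, hqρ, abs_le]
    constructor <;> linarith only [pbc, pbc', pb'c, pb'c', pqb, pqb', pqc, pqc', wBb1, wBb2, wBq1, wBq2, wBb'1, wBb'2,
      wBq'1, wBq'2, wCc1, wCc2, wCbc1, wCbc2, wCc'1, wCc'2, wCbc'1, wCbc'2, wCq1, wCq2, wCb'c1, wCb'c2, wCq'1, wCq'2,
      wCb'c'1, wCb'c'2, eB, eB', eC, eC']
  -- the diagonals `m, n` are long, so `D = ‖m × n‖² > 0`
  have hLm : d ^ 2 - 103 / 50 * t * d ^ 2 ≤ ‖m‖ ^ 2 := by rw [hM]; linarith only [wDb, wBb2, eB, wOb1]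
  have hLn : d ^ 2 - 103 / 50 * t * d ^ 2 ≤ ‖n‖ ^ 2 := by rw [hN]; linarith only [wDc, wCc2, eC, wOc1]
  have hDpos : 0 < ‖ν‖ ^ 2 := by
    have h1 : (d ^ 2 - 103 / 50 * t * d ^ 2) * (d ^ 2 - 103 / 50 * t * d ^ 2) ≤ ‖m‖ ^ 2 * ‖n‖ ^ 2 :=
      mul_le_mul hLm hLn (by linarith only [htd, hd2]) (sq_nonneg _)
    have h2 : ⟪m, n⟫ ^ 2 ≤ (103 / 50 * t * d ^ 2) ^ 2 := sq_le_sq' (abs_le.mp bmn).1 (abs_le.mp bmn).2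
    have h3 : 0 < (d ^ 2 - 2 * (103 / 50 * t * d ^ 2)) * d ^ 2 := mul_pos (by linarith only [htd, hd2]) hd2
    rw [hD]; linarith only [h1, h2, h3]
  -- second order: the in-plane parts `Ẽ(v,v) = D‖v‖² − ⟪v,ν⟫²` are `O(t²)·D` for `v = q, p, w`
  have hEq : ‖ν‖ ^ 2 * ‖q‖ ^ 2 - ⟪q, ν⟫ ^ 2 ≤ 9 * t ^ 2 * d ^ 2 * ‖ν‖ ^ 2 := by
    have i1 := inplane_identity m n q
    rw [← hν] at i1
    have i2 := inplane_le (A := 9 * t ^ 2 * d ^ 2) (by positivity) hLm hLn bqm bqn bmn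
      (num_q (s := d ^ 2) ht).1 (num_q (s := d ^ 2) ht).1 (num_q (s := d ^ 2) ht).2
    rw [hD]; linarith only [i1, i2]
  have hEp : ‖ν‖ ^ 2 * ‖p‖ ^ 2 - ⟪p, ν⟫ ^ 2 ≤ 23 * t ^ 2 * d ^ 2 * ‖ν‖ ^ 2 := by
    have i1 := inplane_identity m n p
    rw [← hν] at i1
    have i2 := inplane_le (A := 23 * t ^ 2 * d ^ 2) (by positivity) hLm hLn bpm bpn bmn
      (num_p (s := d ^ 2) ht).1 (num_p (s := d ^ 2) ht).2.1 (num_p (s := d ^ 2) ht).2.2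
    rw [hD]; linarith only [i1, i2]
  have hEw : ‖ν‖ ^ 2 * ‖w‖ ^ 2 - ⟪w, ν⟫ ^ 2 ≤ 9 * t ^ 2 * d ^ 2 * ‖ν‖ ^ 2 := by
    have i1 := inplane_identity m n w
    rw [← hν] at i1
    have i2 := inplane_le (A := 9 * t ^ 2 * d ^ 2) (by positivity) hLm hLn bwm bwn bmn
      (num_q (s := d ^ 2) ht).1 (num_q (s := d ^ 2) ht).1 (num_q (s := d ^ 2) ht).2
    rw [hD]; linarith only [i1, i2]
  have hq0 : ⟪q, ν⟫ ^ 2 ≤ ‖ν‖ ^ 2 * ‖q‖ ^ 2 := by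
    have := real_inner_mul_inner_self_le q ν
    rw [real_inner_self_eq_norm_sq, real_inner_self_eq_norm_sq] at this
    linarith only [this]
  have hp0 : 0 ≤ ‖ν‖ ^ 2 * ‖p‖ ^ 2 - ⟪p, ν⟫ ^ 2 := by
    have := real_inner_mul_inner_self_le p ν
    rw [real_inner_self_eq_norm_sq, real_inner_self_eq_norm_sq] at this
    linarith only [this]
  have hw0 : 0 ≤ ‖ν‖ ^ 2 * ‖w‖ ^ 2 - ⟪w, ν⟫ ^ 2 := by
    have := real_inner_mul_inner_self_le w ν
    rw [real_inner_self_eq_norm_sq, real_inner_self_eq_norm_sq] at this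
    linarith only [this]
  have hν4 : 0 ≤ (t ^ 2 * d ^ 2 * ‖ν‖ ^ 2) ^ 2 := sq_nonneg _
  -- Cauchy–Schwarz for the three mixed pairings
  have he1 : |‖ν‖ ^ 2 * ⟪q, p⟫ - ⟪q, ν⟫ * ⟪p, ν⟫| ≤ 15 * t ^ 2 * d ^ 2 * ‖ν‖ ^ 2 := by
    refine abs_le_of_sq_le_sq ((proj_cs q p hDpos).trans ?_) (by positivity)
    have := mul_le_mul hEq hEp hp0 (by positivity)
    linarith only [this, hν4]
  have he2 : |‖ν‖ ^ 2 * ⟪q, w⟫ - ⟪q, ν⟫ * ⟪w, ν⟫| ≤ 9 * t ^ 2 * d ^ 2 * ‖ν‖ ^ 2 := by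
    refine abs_le_of_sq_le_sq ((proj_cs q w hDpos).trans ?_) (by positivity)
    have := mul_le_mul hEq hEw hw0 (by positivity)
    linarith only [this, hν4]
  have he3 : |‖ν‖ ^ 2 * ⟪p, w⟫ - ⟪p, ν⟫ * ⟪w, ν⟫| ≤ 15 * t ^ 2 * d ^ 2 * ‖ν‖ ^ 2 := by
    refine abs_le_of_sq_le_sq ((proj_cs p w hDpos).trans ?_) (by positivity)
    have := mul_le_mul hEp hEw hw0 (by positivity)
    linarith only [this, hν4]
  have he21 : |(‖ν‖ ^ 2 * ⟪q, ρ⟫ - ⟪q, ν⟫ * ⟪ρ, ν⟫) - (‖ν‖ ^ 2 * ⟪q, p⟫ - ⟪q, ν⟫ * ⟪p, ν⟫)| ≤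
      9 * t ^ 2 * d ^ 2 * ‖ν‖ ^ 2 := by
    rw [hqw, hwν] at he2
    have e : (‖ν‖ ^ 2 * ⟪q, ρ⟫ - ⟪q, ν⟫ * ⟪ρ, ν⟫) - (‖ν‖ ^ 2 * ⟪q, p⟫ - ⟪q, ν⟫ * ⟪p, ν⟫) =
        -(‖ν‖ ^ 2 * (⟪q, p⟫ - ⟪q, ρ⟫) - ⟪q, ν⟫ * (⟪p, ν⟫ - ⟪ρ, ν⟫)) := by ring
    rw [e, abs_neg]; exact he2
  have he53 : |(‖ν‖ ^ 2 * ‖p‖ ^ 2 - ⟪p, ν⟫ ^ 2) - (‖ν‖ ^ 2 * ⟪p, ρ⟫ - ⟪p, ν⟫ * ⟪ρ, ν⟫)| ≤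
      15 * t ^ 2 * d ^ 2 * ‖ν‖ ^ 2 := by
    rw [hpw, hwν] at he3
    have e : (‖ν‖ ^ 2 * ‖p‖ ^ 2 - ⟪p, ν⟫ ^ 2) - (‖ν‖ ^ 2 * ⟪p, ρ⟫ - ⟪p, ν⟫ * ⟪ρ, ν⟫) =
        ‖ν‖ ^ 2 * (‖p‖ ^ 2 - ⟪p, ρ⟫) - ⟪p, ν⟫ * (⟪p, ν⟫ - ⟪ρ, ν⟫) := by ring
    rw [e]; exact he3
  -- the second-order defect and the conclusion
  have hΔ := delta_bound (D := ‖ν‖ ^ 2) (A := ⟪q, p⟫) (B := ⟪q, ρ⟫) (g := ⟪p, ρ⟫) (z := ‖q‖ ^ 2) (pp := ‖p‖ ^ 2)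
    (P := ⟪p, ν⟫) (Q := ⟪q, ν⟫) (R := ⟪ρ, ν⟫) (d2 := d ^ 2) ht0 ht hd2 hDpos wDq bκb bκc he1 hEq hq0 he21 he53
  obtain ⟨hΔ1, hΔ2⟩ := abs_le.1 hΔ
  obtain ⟨hW1, hW2⟩ := abs_le.1 bW
  have hbb : d ^ 2 ≤ ‖b‖ * ‖b'‖ := by rw [pow_two]; exact mul_le_mul hOb.1 hOb'.1 hd.le (norm_nonneg _)
  have h7 : 0 ≤ 7 / 2 * t * (‖b‖ * ‖b'‖ - d ^ 2) := mul_nonneg (by positivity) (sub_nonneg.2 hbb)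
  rw [abs_le]; constructor <;> linarith only [hΔ1, hΔ2, hW1, hW2, hpp, h7, htd0]

end Summit.AtomisticToContinuum.Crystallization.Theorems.FrustratedLawDichotomyTwoShellRigidityCapBrace

end
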